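import Mathlib
import Summits.ValiantsHypothesis.ValiantsHypothesis.Theorems.RigidityForcesSymmetryRankRigidMinimalReprLaplaceFiveSeparatedCaptureSliceRows

/-!
# The residue form of a coordinate slice at an ARBITRARY letter

Tool for the letter-deletion programme of the 3-slot capture inequality `CaptureIneqSym` (item 24813 stays OPEN).  The cross-pays-slices
criterion (✓ `captureIneqSym_of_slices_le_cross`) needs, at a letter `c` that IS touched by the spans, an upper bound for the space of
`c`-slices of the obligations.  From the finite form `T_μ(p,q,r) = A_r(p,q) + B_q(p,r) + C_p(q,r)` and the residue theorem
(✓ `sub_symPlaced_mem_prolong`: `T_μ − 3·Sym(A) ∈ prolong X`) the `c`-slice of `T_μ` is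

  `A_c + N + J`,  `A_c ∈ U₀₁`,  `N ∈ X` with all rows in `rowIm X c` (✓ `prolong_slice_row_mem`),  `J(p,q) = A_q(p,c) + A_p(q,c)`,

where the JUNK `J` is built from the `c`-columns of members of `U₀₁` only (so `J = 0` when `U₀₁` kills the letter `c`, recovering
✓ `sliceCoord_residue_01`).  Three slots.  All [folklore].
-/

set_option linter.dupNamespace false
set_option autoImplicit false

namespace Summit.ValiantsHypothesis.ValiantsHypothesis.Theorems.RigidityForcesSymmetryRankRigidMinimalRepr

namespace LaplaceFiveSeparatedCapture

open Finset

/-- ★★ **GENERAL RESIDUE FORM OF A COORDINATE SLICE, slot `01`.**  For a captured obligation and any letter `c` there are a tuple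
`A : Fin 5 → U₀₁` and `N ∈ X = U₀₁ ⊔ U₀₂ ⊔ U₁₂` with every row in `rowIm X c` such that
`T_μ(p,q,c) = A_c(p,q) + N(p,q) + (A_q(p,c) + A_p(q,c))`. [folklore] -/
theorem sliceCoord_residue_general_01 (U01 U02 U12 : Submodule ℂ (Fin 5 → Fin 5 → ℂ))
    (h01 : ∀ x ∈ U01, ∀ p q : Fin 5, x p q = x q p) (h02 : ∀ x ∈ U02, ∀ p q : Fin 5, x p q = x q p)
    (h12 : ∀ x ∈ U12, ∀ p q : Fin 5, x p q = x q p) (c : Fin 5)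
    (μ : Fin 5 → Fin 5 → ℂ) (hμ : contractZ μ ∈ L3 U01 U02 U12) :
    ∃ A : Fin 5 → Fin 5 → Fin 5 → ℂ, (∀ r, A r ∈ U01) ∧ ∃ N ∈ U01 ⊔ U02 ⊔ U12,
      (∀ p : Fin 5, (fun q => N p q) ∈ rowIm (U01 ⊔ U02 ⊔ U12) c) ∧
      ∀ p q : Fin 5, contractZ μ p q c = A c p q + N p q + (A q p c + A p q c) := by
  obtain ⟨A, B, C, hA, hB, hC, hT⟩ := L3_finite_form U01 U02 U12 hμ
  have hres := (sub_symPlaced_mem_prolong U01 U02 U12 A B C (contractZ μ) hA hB hC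
    (fun r p q => h01 _ (hA r) p q) (fun r p q => h02 _ (hB r) p q) (fun r p q => h12 _ (hC r) p q) hT
    (fun p q r => contractZ_swap12 μ p q r) (fun p q r => contractZ_swap23 μ p q r)).2.2
  refine ⟨A, hA, fun p q => (contractZ μ - fun p q r => A r p q + A q p r + A p q r) p q c,
    slice_last_mem_of_mem_prolong _ hres c, fun p => prolong_slice_row_mem _ hres c p, fun p q => ?_⟩
  simp only [Pi.sub_apply]
  ring

/-- ★★ **GENERAL RESIDUE FORM OF A COORDINATE SLICE, slot `02`** (`T_μ(p,q,c) = B_c(p,q) + N(p,q) + (B_q(p,c) + B_p(q,c))`). [folklore] -/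
theorem sliceCoord_residue_general_02 (U01 U02 U12 : Submodule ℂ (Fin 5 → Fin 5 → ℂ))
    (h01 : ∀ x ∈ U01, ∀ p q : Fin 5, x p q = x q p) (h02 : ∀ x ∈ U02, ∀ p q : Fin 5, x p q = x q p)
    (h12 : ∀ x ∈ U12, ∀ p q : Fin 5, x p q = x q p) (c : Fin 5)
    (μ : Fin 5 → Fin 5 → ℂ) (hμ : contractZ μ ∈ L3 U01 U02 U12) :
    ∃ B : Fin 5 → Fin 5 → Fin 5 → ℂ, (∀ r, B r ∈ U02) ∧ ∃ N ∈ U01 ⊔ U02 ⊔ U12,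
      (∀ p : Fin 5, (fun q => N p q) ∈ rowIm (U01 ⊔ U02 ⊔ U12) c) ∧
      ∀ p q : Fin 5, contractZ μ p q c = B c p q + N p q + (B q p c + B p q c) := by
  obtain ⟨A, B, C, hA, hB, hC, hT⟩ := L3_finite_form U01 U02 U12 hμ
  have hres := (sub_symPlaced_mem_prolong U01 U02 U12 A B C (contractZ μ) hA hB hC
    (fun r p q => h01 _ (hA r) p q) (fun r p q => h02 _ (hB r) p q) (fun r p q => h12 _ (hC r) p q) hT
    (fun p q r => contractZ_swap12 μ p q r) (fun p q r => contractZ_swap23 μ p q r)).2.1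
  refine ⟨B, hB, fun p q => (contractZ μ - fun p q r => B r p q + B q p r + B p q r) p q c,
    slice_last_mem_of_mem_prolong _ hres c, fun p => prolong_slice_row_mem _ hres c p, fun p q => ?_⟩
  simp only [Pi.sub_apply]
  ring

/-- ★★ **GENERAL RESIDUE FORM OF A COORDINATE SLICE, slot `12`** (`T_μ(p,q,c) = C_c(p,q) + N(p,q) + (C_q(p,c) + C_p(q,c))`). [folklore] -/
theorem sliceCoord_residue_general_12 (U01 U02 U12 : Submodule ℂ (Fin 5 → Fin 5 → ℂ))
    (h01 : ∀ x ∈ U01, ∀ p q : Fin 5, x p q = x q p) (h02 : ∀ x ∈ U02, ∀ p q : Fin 5, x p q = x q p)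
    (h12 : ∀ x ∈ U12, ∀ p q : Fin 5, x p q = x q p) (c : Fin 5)
    (μ : Fin 5 → Fin 5 → ℂ) (hμ : contractZ μ ∈ L3 U01 U02 U12) :
    ∃ C : Fin 5 → Fin 5 → Fin 5 → ℂ, (∀ r, C r ∈ U12) ∧ ∃ N ∈ U01 ⊔ U02 ⊔ U12,
      (∀ p : Fin 5, (fun q => N p q) ∈ rowIm (U01 ⊔ U02 ⊔ U12) c) ∧
      ∀ p q : Fin 5, contractZ μ p q c = C c p q + N p q + (C q p c + C p q c) := by
  obtain ⟨A, B, C, hA, hB, hC, hT⟩ := L3_finite_form U01 U02 U12 hμ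
  have hres := (sub_symPlaced_mem_prolong U01 U02 U12 A B C (contractZ μ) hA hB hC
    (fun r p q => h01 _ (hA r) p q) (fun r p q => h02 _ (hB r) p q) (fun r p q => h12 _ (hC r) p q) hT
    (fun p q r => contractZ_swap12 μ p q r) (fun p q r => contractZ_swap23 μ p q r)).1
  refine ⟨C, hC, fun p q => (contractZ μ - fun p q r => C r p q + C q p r + C p q r) p q c,
    slice_last_mem_of_mem_prolong _ hres c, fun p => prolong_slice_row_mem _ hres c p, fun p q => ?_⟩
  simp only [Pi.sub_apply]
  ring

/-- ★ **THE JUNK LIVES ON THE `c`-COLUMNS OF THE SLOT.**  If the `c`-th rows of all members of `U₀₁` lie in a subspace `V ≤ ℂ⁵`, the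
junk term of `sliceCoord_residue_general_01` is `(p,q) ↦ a_q(p) + a_p(q)` with all `a_q ∈ V`. [folklore] -/
theorem junk_rows_mem (U01 : Submodule ℂ (Fin 5 → Fin 5 → ℂ)) (h01 : ∀ x ∈ U01, ∀ p q : Fin 5, x p q = x q p)
    (V : Submodule ℂ (Fin 5 → ℂ)) (c : Fin 5) (hV : ∀ x ∈ U01, x c ∈ V)
    (A : Fin 5 → Fin 5 → Fin 5 → ℂ) (hA : ∀ r, A r ∈ U01) (q : Fin 5) :
    (fun p => A q p c) ∈ V := by
  have e : (fun p => A q p c) = (A q) c := by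
    funext p
    exact h01 _ (hA q) p c
  rw [e]
  exact hV _ (hA q)

end LaplaceFiveSeparatedCapture

end Summit.ValiantsHypothesis.ValiantsHypothesis.Theorems.RigidityForcesSymmetryRankRigidMinimalRepr
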